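import Summits.AtomisticToContinuum.BoseEinsteinCondensation.Theorems.BECConjugateDominationDefs
import Summits.AtomisticToContinuum.BoseEinsteinCondensation.Theorems.StaticResponseBound.Negative.Basic
import Literature.MathematicalPhysics.QuantumManyBody.PeriodicBoseGasTagged
import Literature.MathematicalPhysics.QuantumManyBody.PeriodicBoseGasEq317

/-!
# Negative lemmas for crux `InfraredMinimumUncertainty` (stmt-AtomisticToContinuum-11784) — V:
# `0 ≤ g ≤ 1 = g(0)` and the zero mode (`m ≠ 0` is NOT load-bearing)

Supports (does not close) stmt-AtomisticToContinuum-11784 (route `BECConjugateDomination`).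
Importable form of §B of the cdisprove seat's standing file
`Cruxes/InfraredMinimumUncertainty/Disproof.lean`.  Over the landed vocabulary `coherence` (`g`),
`levyWeight` (`ν`), `structureFactor` (`S`) of `Theorems/BECConjugateDominationDefs.lean`, for
EVERY admissible periodic state (no minimality, no positivity):

* `lintegral_slice_shift_eq_one` (`∫_cell∫_{cell^n}|Ψ(x+r,Y)|² = 1`: Tonelli with particle `0`
  split off `setLIntegral_cellN_succ_left` + the torus shift of the fundamental cell
  `lintegral_cellN_comp_add` + normalisation), `coherence_eq_toReal`;
* `coherence_le_one` (**`g ≤ 1`**, by AM–GM under the integral), `coherence_zero` (`g(0) = 1`),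
  `coherence_nonneg`, `log_coherence_nonpos` — the inputs `0 < g ≤ 1` of the route's glue
  `IMUChainGlue` step (ii), now available to its prover;
* `levyWeight_zero_nonpos` (`ν₀ = L⁻³∫ log g ≤ 0`), `structureFactor_zero` (`S₀ = N`),
  `pi_zero_nonpos` (`Π₀ = N²ν₀ ≤ 0`), and `imu_iff_allModes`: the crux is equivalent to its
  version WITHOUT the guard `m ≠ 0` — that hypothesis is not load-bearing (information for the
  provers: nothing in a proof may hinge on `m ≠ 0` except through `S_m`/`ν_m` themselves).
-/

noncomputable section

open MeasureTheory Filter Set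
open scoped ENNReal NNReal Topology ComplexConjugate BigOperators

namespace Summit.AtomisticToContinuum.BoseEinsteinCondensation.Theorems.InfraredMinimumUncertainty.Negative

open Literature.MathematicalPhysics.QuantumManyBody.BoseGas
open Summit.AtomisticToContinuum.BoseEinsteinCondensation.Theses.BECConjugateDomination
open Summit.AtomisticToContinuum.BoseEinsteinCondensation.Cruxes.InfraredMinimumUncertainty.FisherGaussianDensityMode
open Summit.AtomisticToContinuum.BoseEinsteinCondensation.Theorems.StaticResponseBound.Negative
  (integral_norm_sq_eq_one)

section MZero

variable {n : ℕ} {L : ℝ}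

/-- **Shifted slice normalisation**: `∫_cell dx ∫_{cell^n} dY |Ψ(x + r, Y)|² = 1` for every
admissible `Ψ` and every shift `r` (Tonelli with particle `0` split off, then the torus shift
`X ↦ X + (r, 0, …, 0)` of the fundamental cell, then `‖Ψ‖ = 1`). [folklore] -/
theorem lintegral_slice_shift_eq_one (hL : 0 < L) (Ψ : PeriodicTrialState (n + 1) L) (r : Space) :
    ∫⁻ x in cell L, ∫⁻ Y in cellN n L, (‖Ψ.ψ (Matrix.vecCons (x + r) Y)‖₊ : ℝ≥0∞) ^ 2 = 1 := by
  set C : Config (n + 1) := Matrix.vecCons r 0 with hC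
  have hcont : Continuous fun X : Config (n + 1) => Ψ.ψ (X + C) :=
    Ψ.contDiff.continuous.comp (continuous_id.add continuous_const)
  have hF : Measurable fun X : Config (n + 1) => (‖Ψ.ψ (X + C)‖₊ : ℝ≥0∞) ^ 2 :=
    hcont.measurable.nnnorm.coe_nnreal_ennreal.pow_const _
  have h1 := setLIntegral_cellN_succ_left (L := L) hF
  have hcons : ∀ (x : Space) (Y : Config n), Matrix.vecCons x Y + C = Matrix.vecCons (x + r) Y := by
    intro x Y
    rw [hC, Matrix.cons_add_cons, add_zero]
  simp only [hcons] at h1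
  rw [← h1, lintegral_cellN_comp_add hL (G := fun X => (‖Ψ.ψ X‖₊ : ℝ≥0∞) ^ 2)
    (fun X i k => by simp only [Ψ.periodic]) C]
  exact Ψ.norm_eq

/-- The unshifted slice normalisation `∫_cell dx ∫_{cell^n} dY |Ψ(x, Y)|² = 1`. [folklore] -/
theorem lintegral_slice_eq_one (hL : 0 < L) (Ψ : PeriodicTrialState (n + 1) L) :
    ∫⁻ x in cell L, ∫⁻ Y in cellN n L, (‖Ψ.ψ (Matrix.vecCons x Y)‖₊ : ℝ≥0∞) ^ 2 = 1 := by
  simpa using lintegral_slice_shift_eq_one hL Ψ 0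

/-- Measurability of the shifted slice `Y ↦ |Ψ(x + r, Y)|²`. [folklore] -/
theorem measurable_sliceSq (Ψ : PeriodicTrialState (n + 1) L) (x : Space) :
    Measurable fun Y : Config n => (‖Ψ.ψ (Matrix.vecCons x Y)‖₊ : ℝ≥0∞) ^ 2 :=
  (Ψ.contDiff.continuous.comp (continuous_const.matrixVecCons continuous_id)).measurable.nnnorm
    |>.coe_nnreal_ennreal.pow_const _

/-- Measurability of `x ↦ ∫_{cell^n} |Ψ(x + r, Y)|² dY`. [folklore] -/
theorem measurable_lintegral_sliceSq (Ψ : PeriodicTrialState (n + 1) L) (r : Space) :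
    Measurable fun x : Space => ∫⁻ Y in cellN n L, (‖Ψ.ψ (Matrix.vecCons (x + r) Y)‖₊ : ℝ≥0∞) ^ 2 := by
  have hc : Continuous fun q : Space × Config n => Ψ.ψ (Matrix.vecCons (q.1 + r) q.2) := by
    have := Ψ.contDiff.continuous; fun_prop
  exact (hc.measurable.nnnorm.coe_nnreal_ennreal.pow_const _).lintegral_prod_right'
    (ν := volume.restrict (cellN n L))

/-- The coherence as a Lebesgue integral (the integrand is non-negative and continuous). [folklore] -/
theorem coherence_eq_toReal (hL : 0 < L) (Ψ : PeriodicTrialState (n + 1) L) (r : Space) :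
    coherence n L Ψ r = (∫⁻ x in cell L, ∫⁻ Y in cellN n L,
      ENNReal.ofReal (‖Ψ.ψ (Matrix.vecCons (x + r) Y)‖ * ‖Ψ.ψ (Matrix.vecCons x Y)‖)).toReal := by
  unfold coherence
  have hc := Ψ.contDiff.continuous
  have hp : Continuous fun q : Space × Config n =>
      ‖Ψ.ψ (Matrix.vecCons (q.1 + r) q.2)‖ * ‖Ψ.ψ (Matrix.vecCons q.1 q.2)‖ := by fun_prop
  have hinner : ∀ x : Space, ∫ Y in cellN n L, ‖Ψ.ψ (Matrix.vecCons (x + r) Y)‖ *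
      ‖Ψ.ψ (Matrix.vecCons x Y)‖ = (∫⁻ Y in cellN n L,
        ENNReal.ofReal (‖Ψ.ψ (Matrix.vecCons (x + r) Y)‖ * ‖Ψ.ψ (Matrix.vecCons x Y)‖)).toReal := by
    intro x
    have hx : Continuous fun Y : Config n =>
        ‖Ψ.ψ (Matrix.vecCons (x + r) Y)‖ * ‖Ψ.ψ (Matrix.vecCons x Y)‖ := by fun_prop
    exact integral_eq_lintegral_of_nonneg_ae (Eventually.of_forall fun Y => by positivity)
      hx.aestronglyMeasurable
  simp_rw [hinner]
  have hmeas : Measurable fun x : Space => ∫⁻ Y in cellN n L,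
      ENNReal.ofReal (‖Ψ.ψ (Matrix.vecCons (x + r) Y)‖ * ‖Ψ.ψ (Matrix.vecCons x Y)‖) :=
    (ENNReal.measurable_ofReal.comp hp.measurable).lintegral_prod_right'
      (ν := volume.restrict (cellN n L))
  -- a.e. finiteness of the slices from AM–GM and the finite slice normalisations
  have hbound : ∀ x : Space, ∫⁻ Y in cellN n L,
      ENNReal.ofReal (‖Ψ.ψ (Matrix.vecCons (x + r) Y)‖ * ‖Ψ.ψ (Matrix.vecCons x Y)‖) ≤
      (∫⁻ Y in cellN n L, (‖Ψ.ψ (Matrix.vecCons (x + r) Y)‖₊ : ℝ≥0∞) ^ 2) +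
        ∫⁻ Y in cellN n L, (‖Ψ.ψ (Matrix.vecCons x Y)‖₊ : ℝ≥0∞) ^ 2 := by
    intro x
    rw [← lintegral_add_left (measurable_sliceSq Ψ (x + r))]
    refine lintegral_mono fun Y => ?_
    rw [coe_nnnorm_sq_eq_ofReal, coe_nnnorm_sq_eq_ofReal, ← ENNReal.ofReal_add (sq_nonneg _) (sq_nonneg _)]
    exact ENNReal.ofReal_le_ofReal (by nlinarith [sq_nonneg (‖Ψ.ψ (Matrix.vecCons (x + r) Y)‖ -
      ‖Ψ.ψ (Matrix.vecCons x Y)‖)])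
  have hfin : ∀ᵐ x ∂(volume.restrict (cell L)), ∫⁻ Y in cellN n L,
      ENNReal.ofReal (‖Ψ.ψ (Matrix.vecCons (x + r) Y)‖ * ‖Ψ.ψ (Matrix.vecCons x Y)‖) < ⊤ := by
    have hm1 := measurable_lintegral_sliceSq Ψ r
    have hm2 : Measurable fun x : Space => ∫⁻ Y in cellN n L,
        (‖Ψ.ψ (Matrix.vecCons x Y)‖₊ : ℝ≥0∞) ^ 2 := by
      simpa using measurable_lintegral_sliceSq Ψ 0
    have h1 : ∀ᵐ x ∂(volume.restrict (cell L)), ∫⁻ Y in cellN n L,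
        (‖Ψ.ψ (Matrix.vecCons (x + r) Y)‖₊ : ℝ≥0∞) ^ 2 < ⊤ :=
      ae_lt_top hm1 (by rw [lintegral_slice_shift_eq_one hL Ψ r]; exact ENNReal.one_ne_top)
    have h2 : ∀ᵐ x ∂(volume.restrict (cell L)), ∫⁻ Y in cellN n L,
        (‖Ψ.ψ (Matrix.vecCons x Y)‖₊ : ℝ≥0∞) ^ 2 < ⊤ :=
      ae_lt_top hm2 (by rw [lintegral_slice_eq_one hL Ψ]; exact ENNReal.one_ne_top)
    filter_upwards [h1, h2] with x hx1 hx2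
    exact (hbound x).trans_lt (ENNReal.add_lt_top.mpr ⟨hx1, hx2⟩)
  rw [integral_toReal hmeas.aemeasurable hfin]

/-- **`g ≤ 1`**: the coherence of every admissible state is at most `1` at every `r`
(AM–GM `|Ψ(x+r,Y)||Ψ(x,Y)| ≤ (|Ψ(x+r,Y)|² + |Ψ(x,Y)|²)/2`, shift invariance of the cell
integral, normalisation). [folklore] -/
theorem coherence_le_one (hL : 0 < L) (Ψ : PeriodicTrialState (n + 1) L) (r : Space) :
    coherence n L Ψ r ≤ 1 := by
  rw [coherence_eq_toReal hL]
  have hc := Ψ.contDiff.continuous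
  have key : (∫⁻ x in cell L, ∫⁻ Y in cellN n L,
      ENNReal.ofReal (‖Ψ.ψ (Matrix.vecCons (x + r) Y)‖ * ‖Ψ.ψ (Matrix.vecCons x Y)‖)) ≤ 1 := by
    have h2 : (∫⁻ x in cell L, ∫⁻ Y in cellN n L, 2 * ENNReal.ofReal
        (‖Ψ.ψ (Matrix.vecCons (x + r) Y)‖ * ‖Ψ.ψ (Matrix.vecCons x Y)‖)) ≤
        (∫⁻ x in cell L, ∫⁻ Y in cellN n L, (‖Ψ.ψ (Matrix.vecCons (x + r) Y)‖₊ : ℝ≥0∞) ^ 2) +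
          ∫⁻ x in cell L, ∫⁻ Y in cellN n L, (‖Ψ.ψ (Matrix.vecCons (x + 0) Y)‖₊ : ℝ≥0∞) ^ 2 := by
      rw [← lintegral_add_left (measurable_lintegral_sliceSq Ψ r)]
      refine lintegral_mono fun x => ?_
      rw [← lintegral_add_left (measurable_sliceSq Ψ (x + r))]
      refine lintegral_mono fun Y => ?_
      rw [add_zero, coe_nnnorm_sq_eq_ofReal, coe_nnnorm_sq_eq_ofReal,
        ← ENNReal.ofReal_add (sq_nonneg _) (sq_nonneg _)]
      have h2e : (2 : ℝ≥0∞) * ENNReal.ofReal (‖Ψ.ψ (Matrix.vecCons (x + r) Y)‖ *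
          ‖Ψ.ψ (Matrix.vecCons x Y)‖) = ENNReal.ofReal (2 * (‖Ψ.ψ (Matrix.vecCons (x + r) Y)‖ *
            ‖Ψ.ψ (Matrix.vecCons x Y)‖)) := by
        rw [ENNReal.ofReal_mul (by norm_num : (0 : ℝ) ≤ 2), ENNReal.ofReal_ofNat]
      rw [h2e]
      exact ENNReal.ofReal_le_ofReal (by nlinarith [sq_nonneg (‖Ψ.ψ (Matrix.vecCons (x + r) Y)‖ -
        ‖Ψ.ψ (Matrix.vecCons x Y)‖)])
    rw [lintegral_slice_shift_eq_one hL Ψ r, lintegral_slice_shift_eq_one hL Ψ 0] at h2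
    have hmul : (∫⁻ x in cell L, ∫⁻ Y in cellN n L, 2 * ENNReal.ofReal
        (‖Ψ.ψ (Matrix.vecCons (x + r) Y)‖ * ‖Ψ.ψ (Matrix.vecCons x Y)‖)) =
        2 * ∫⁻ x in cell L, ∫⁻ Y in cellN n L, ENNReal.ofReal
          (‖Ψ.ψ (Matrix.vecCons (x + r) Y)‖ * ‖Ψ.ψ (Matrix.vecCons x Y)‖) := by
      rw [← lintegral_const_mul' _ _ ENNReal.ofNat_ne_top]
      refine lintegral_congr fun x => ?_
      rw [lintegral_const_mul' _ _ ENNReal.ofNat_ne_top]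
    have h12 : (1 : ℝ≥0∞) + 1 = 2 * 1 := by norm_num
    rw [hmul, h12] at h2
    exact (ENNReal.mul_le_mul_iff_right two_ne_zero ENNReal.ofNat_ne_top).mp h2
  calc _ ≤ (1 : ℝ≥0∞).toReal := ENNReal.toReal_mono ENNReal.one_ne_top key
    _ = 1 := ENNReal.toReal_one

/-- **`g(0) = 1`** (normalisation). [folklore] -/
theorem coherence_zero (hL : 0 < L) (Ψ : PeriodicTrialState (n + 1) L) :
    coherence n L Ψ 0 = 1 := by
  rw [coherence_eq_toReal hL]
  have : ∀ (x : Space) (Y : Config n), ENNReal.ofReal (‖Ψ.ψ (Matrix.vecCons (x + 0) Y)‖ *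
      ‖Ψ.ψ (Matrix.vecCons x Y)‖) = (‖Ψ.ψ (Matrix.vecCons x Y)‖₊ : ℝ≥0∞) ^ 2 := by
    intro x Y
    rw [add_zero, coe_nnnorm_sq_eq_ofReal, sq]
  simp_rw [this]
  rw [lintegral_slice_eq_one hL Ψ, ENNReal.toReal_one]

/-- `0 ≤ g`. [folklore] -/
theorem coherence_nonneg (Ψ : PeriodicTrialState (n + 1) L) (r : Space) : 0 ≤ coherence n L Ψ r :=
  integral_nonneg fun x => integral_nonneg fun Y => by positivity

/-- `log g ≤ 0` pointwise. [folklore] -/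
theorem log_coherence_nonpos (hL : 0 < L) (Ψ : PeriodicTrialState (n + 1) L) (r : Space) :
    Real.log (coherence n L Ψ r) ≤ 0 :=
  Real.log_nonpos (coherence_nonneg Ψ r) (coherence_le_one hL Ψ r)

/-- **The zero mode of the Lévy weight is non-positive**: `ν₀ = L⁻³ ∫_cell log g ≤ 0`. [folklore] -/
theorem levyWeight_zero_nonpos (hL : 0 < L) (Ψ : PeriodicTrialState (n + 1) L) :
    levyWeight n L Ψ 0 ≤ 0 := by
  unfold levyWeight
  rw [cellFourierCoeff_zero hL, Complex.smul_re, smul_eq_mul]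
  refine mul_nonpos_of_nonneg_of_nonpos (by positivity) ?_
  have h := integral_re (f := fun r : Space => ((Real.log (coherence n L Ψ r) : ℝ) : ℂ))
    (μ := volume.restrict (cell L))
  by_cases hint : Integrable (fun r : Space => ((Real.log (coherence n L Ψ r) : ℝ) : ℂ))
      (volume.restrict (cell L))
  · have h2 := h hint
    simp only [RCLike.re_to_complex, Complex.ofReal_re] at h2
    rw [← h2]
    exact integral_nonpos fun r => log_coherence_nonpos hL Ψ r
  · rw [integral_undef hint, Complex.zero_re]

/-- **The zero mode of the structure factor is `N`**: `S₀ = N⁻¹ ∫ |∑ⱼ 1|² |Ψ|² = N`. [folklore] -/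
theorem structureFactor_zero (Ψ : PeriodicTrialState (n + 1) L) :
    structureFactor n L Ψ 0 = (n : ℝ) + 1 := by
  unfold structureFactor
  simp only [cellWave_zero, Finset.sum_const, Finset.card_univ, Fintype.card_fin, nsmul_eq_mul,
    mul_one]
  have : ∀ X : Config (n + 1), ‖((n + 1 : ℕ) : ℂ)‖ ^ 2 * ‖Ψ.ψ X‖ ^ 2 =
      ((n : ℝ) + 1) ^ 2 * ‖Ψ.ψ X‖ ^ 2 := fun X => by
    rw [Complex.norm_natCast]; push_cast; ring
  simp_rw [this]
  rw [integral_const_mul, integral_norm_sq_eq_one]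
  have hN : (n : ℝ) + 1 ≠ 0 := by positivity
  field_simp

/-- **`m = 0` is harmless**: `Π₀ = N · ν₀ · S₀ = N² · ν₀ ≤ 0` for EVERY admissible state (not only
minimisers), so the crux's hypothesis `m ≠ 0` is not load-bearing — IMU is equivalent to IMU
stated for all `m ∈ ℤ³` (`imu_iff_allModes`). [folklore] -/
theorem pi_zero_nonpos (hL : 0 < L) (Ψ : PeriodicTrialState (n + 1) L) :
    ((n : ℝ) + 1) * levyWeight n L Ψ 0 * structureFactor n L Ψ 0 ≤ 0 := by
  rw [structureFactor_zero Ψ,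
    show ((n : ℝ) + 1) * levyWeight n L Ψ 0 * ((n : ℝ) + 1) = ((n : ℝ) + 1) ^ 2 * levyWeight n L Ψ 0
      by ring]
  exact mul_nonpos_of_nonneg_of_nonpos (by positivity) (levyWeight_zero_nonpos hL Ψ)


/-- The crux with the hypothesis `m ≠ 0` DELETED (the bound asked for ALL modes `m ∈ ℤ³`,
everything else verbatim). -/
def InfraredMinimumUncertaintyAllModes : Prop :=
  ∀ v : ℝ → ℝ≥0∞, IsRepulsiveFiniteRange v → (∀ r, v r ≠ ⊤) →
    ContDiff ℝ 2 (fun x : Space => (v ‖x‖).toReal) →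
    (∃ Cₑ : ℝ, ∀ x : Space, ‖iteratedFDeriv ℝ 2 (fun x : Space => (v ‖x‖).toReal) x‖ ≤
      Cₑ * Real.sqrt ((v ‖x‖).toReal)) →
    ∃ C : ℝ, 0 ≤ C ∧ ∃ ρ₀ : ℝ, 0 < ρ₀ ∧ ∀ ρ : ℝ, 0 < ρ → ρ < ρ₀ →
      ∀ᶠ n : ℕ in Filter.atTop, ∀ Ψ : PeriodicTrialState (n + 1) (sideLength ρ (n + 1)),
        (let L : ℝ := sideLength ρ (n + 1)
        let g : Space → ℝ := fun r => ∫ x in cell L, ∫ Y in cellN n L,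
          ‖Ψ.ψ (Matrix.vecCons (x + r) Y)‖ * ‖Ψ.ψ (Matrix.vecCons x Y)‖
        let ν : (Fin 3 → ℤ) → ℝ := fun m =>
          (cellFourierCoeff L (fun r : Space => ((Real.log (g r) : ℝ) : ℂ)) m).re
        let S : (Fin 3 → ℤ) → ℝ := fun m => ((n : ℝ) + 1)⁻¹ *
          ∫ X in cellN (n + 1) L, ‖∑ j : Fin (n + 1), cellWave L m (X j)‖ ^ 2 * ‖Ψ.ψ X‖ ^ 2
        periodicEnergy v Ψ = periodicGroundStateEnergy v (n + 1) L → periodicEnergy v Ψ ≠ ⊤ →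
          (∀ X, Ψ.ψ X = (‖Ψ.ψ X‖ : ℂ)) → (∀ X, Ψ.ψ X ≠ 0) →
            ∀ m : Fin 3 → ℤ, ((n : ℝ) + 1) * ν m * S m ≤ C)

/-- **`m ≠ 0` is not load-bearing**: the crux is EQUIVALENT to its all-modes version, because
`Π₀ ≤ 0 ≤ C` for every admissible state (`pi_zero_nonpos`).  (Contrast: for the sibling crux
`StaticResponseBound` the analogous guard `k ≠ 0` IS load-bearing.) [folklore] -/
theorem imu_iff_allModes : InfraredMinimumUncertainty ↔ InfraredMinimumUncertaintyAllModes := by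
  constructor
  · intro h v h₁ h₂ h₃ h₄
    obtain ⟨C, hC, ρ₀, hρ₀, hB⟩ := h v h₁ h₂ h₃ h₄
    refine ⟨C, hC, ρ₀, hρ₀, fun ρ hρ hρρ₀ => ?_⟩
    filter_upwards [hB ρ hρ hρρ₀] with n hn Ψ
    intro L g ν S hE hfin hreal hpos m
    by_cases hm : m = 0
    · subst hm
      have hL : 0 < sideLength ρ (n + 1) := by
        unfold sideLength; exact Real.rpow_pos_of_pos (by positivity) _
      have key : ((n : ℝ) + 1) * levyWeight n (sideLength ρ (n + 1)) Ψ 0 *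
          structureFactor n (sideLength ρ (n + 1)) Ψ 0 ≤ 0 := pi_zero_nonpos hL Ψ
      exact key.trans hC
    · exact hn Ψ hE hfin hreal hpos m hm
  · intro h v h₁ h₂ h₃ h₄
    obtain ⟨C, hC, ρ₀, hρ₀, hB⟩ := h v h₁ h₂ h₃ h₄
    refine ⟨C, hC, ρ₀, hρ₀, fun ρ hρ hρρ₀ => ?_⟩
    filter_upwards [hB ρ hρ hρρ₀] with n hn Ψ
    intro L g ν S hE hfin hreal hpos m _hm
    exact hn Ψ hE hfin hreal hpos m

end MZero

end Summit.AtomisticToContinuum.BoseEinsteinCondensation.Theorems.InfraredMinimumUncertainty.Negative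

end
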